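import Summits.CriticalPhenomena.Ising3DConformalLimit.Theses.HelsonAxis
import Literature.Probability.LatticeModels.PointwiseScalingLimitEtaExists
import Literature.Probability.LatticeModels.CriticalAxisRatioRegularity

/-!
# Birth skeleton for crux `AxialHelsonCone` (stmt-CriticalPhenomena-18121), route `HelsonAxis`

Crux (rank 2 of `route-CriticalPhenomena-HelsonAxis`, sub-problem `Ising3DConformalLimit`; rev 6 = the load-bearing
ORDER-2 part of the card's Helson cone): with `g(n) := ⟨σ₀σ_{n e₀}⟩⁺_{β_c(3)} = criticalTwoPoint 3 (Pi.single 0 n)`,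

  `∃ ℓ₀ > 0, ∀ N ≥ ℓ₀, ∀ b ≥ 1, g(N b)² ≤ g(N) · g(N b²)`

— every 2×2 Helson minor of the axial critical two-point function of the n.n. Ising model on `ℤ³` along a
geometric ray is eventually non-negative (MULTIPLICATIVE midpoint log-convexity of `m ↦ log g(N bᵐ)`), equivalently
(refuter VETTING.md on the item) the WINDOW-AVERAGED effective exponent `s(N,b) := log(g(N)/g(Nb))/log b` is
non-increasing along geometric windows: `s(Nb, b) ≤ s(N, b)`.

## The line: monotone DISCRETE LOCAL EXPONENT (the finest-scale form of "s_eff ↓ 2Δ from above")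

Write `σ(n) := log(g(n)/g(n+1)) / log((n+1)/n)` for the discrete local exponent of the axial function (for a pure
power `n^{-s}` it is identically `s`, lemma `localExponent_rpow` below). The tree already knows, from reflection
positivity (ADC21 Prop. 5.3, `criticalTwoPoint_axis_ratio_mono`), that the DEFICITS `d(n) := log(g(n)/g(n+1)) = σ(n)·log(1+1/n)`
are non-increasing; the line asks one notch more — that they decay at least at the pure-power rate,
`d(n+1)/d(n) ≤ log(1+1/(n+1))/log(1+1/n)`, i.e. `σ` itself is eventually non-increasing — and transfers that to
every geometric window by an exact telescoping identity.

* `stub_localExponentAntitone` (OPEN — THE LOAD-BEARING STUB): `∃ n₀ ≥ 1, ∀ n ≥ n₀, σ(n+1) ≤ σ(n)`.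
  Why plausibly true: it is what the route's infinite-volume Monte-Carlo of the axial function displays
  (route header CHEAPEST FALSIFIER, kit j022798/j022800: `s_eff(n)` decreases monotonically from `n = 2` through the whole
  window `n ≤ 31`, approaching `2Δ_σ = 1.0363` from above); asymptotically it is the SAME bet as the crux (sign `b₀ > 0`
  of the leading axial correction to scaling, `σ(n) ≈ 2Δ + b₀ ω n^{-ω} + 2c n^{-2}`, MC `c ≈ +0.3`) plus unit-step
  regularity, and it follows from convexity of `t ↦ log G(eᵗ)` for the Laplace-transform (transfer-matrix) interpolant
  `G(t) = ∫ e^{-m t} dν(m)` of `g`, since `σ(n)` is the average of `-(log G ∘ exp)'` over `[log n, log(n+1)]`.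
  It does NOT assert existence of `η`, an amplitude, or any rate (those stay with `EtaBoundsExist` / `HelsonForcing`
  on the route): a monotone bounded `σ` converges, but `g(n)·n^{lim σ}` may still tend to `0`.
  Why it might fail: exactly as the crux — `b₀ < 0` (approach to `2Δ` from below beyond `n ~ 40`), or a lattice-scale
  non-monotonicity of `σ` at some isolated large `n` that window averages would wash out (the stub is strictly
  stronger than the crux: unit windows instead of geometric ones).
* `stub_antitoneExponentTransfer` (the ENGINE — pure real analysis, provable, M-sized in Lean): for EVERY positive
  sequence `f` and `n₀ ≥ 1`, if `σ_f(n+1) ≤ σ_f(n)` for `n ≥ n₀` then `f(Nb)² ≤ f(N)·f(Nb²)` for all `N ≥ n₀`, `b ≥ 1`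
  (same threshold). Proof route (checked by hand, see `Lines/birth.md`): with `h = log f`, `L(k) = log((k+1)/k) > 0`,
  `h(bn) − h(bn+b) = Σ_{k=bn}^{bn+b−1} σ(k) L(k) ≤ σ(n) Σ_{k=bn}^{bn+b-1} L(k) = σ(n) · log((n+1)/n) = h(n) − h(n+1)`
  for `n ≥ n₀` (because `k ≥ bn ≥ n`), i.e. the dilation ratio `r_b(n) := f(bn)/f(n)` is non-decreasing on `[n₀, ∞)`;
  hence `r_b(N) ≤ r_b(Nb)`, which is the minor inequality after clearing the positive denominators.
* `AxialHelsonCone_of` (REAL PROOF, this file): instantiate the engine at `f := g`, positivity from the tree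
  (`criticalTwoPoint_axis_pos`, Simon–Lieb), threshold `ℓ₀ := n₀`.

Neither stub is cheaply the crux or the summit (BC3 probes `stub → AxialHelsonCone`, `stub → Ising3DConformalLimit` by
`first | exact? | simpa | aesop` all FAIL — planner folder `bc/AxialHelsonCone_birth_probes.lean`, quoted in `Lines/birth.md`):
the open stub speaks of three CONSECUTIVE distances and says nothing about geometric triples `(N, Nb, Nb²)` without the
telescoping engine, and the engine is a statement about arbitrary positive sequences whose hypothesis is open for `g`.
Conversely the crux does not give the open stub (window monotonicity along geometric progressions does not force unit-step
monotonicity), so the stub is a genuine strengthening, not a rewording; its `why easier`: it is LOCAL (a three-term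
inequality in `g(n), g(n+1), g(n+2)`, one derivative beyond the in-tree RP monotonicity of `d(n)`), hence open to
transfer-matrix / spectral-measure and correction-to-scaling analysis at a single scale, whereas the crux couples the
scales `N` and `N b²` for unbounded `b`.

Alternative line NOT registered here (route header TWO-LAYER PLAN, "SignOfLeadingCorrection"): a one-term Wegner form
`g(n) = A n^{-2Δ}(1 + b₀ n^{-ω}(1 + o(1)))` with `b₀ > 0` implies the crux directly (uniformly in `b`, because all three
points `N, Nb, Nb²` lie beyond `N`); it is recorded in `Lines/birth.md` only, because as a stub it would assert the axial
power law WITH amplitude — the very output the crux feeds into `HelsonForcing` — and so would not make the crux easier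
than its use.

Disproof used: no `Disproof.lean` on the crux at registration (`ledger crux ls stmt-CriticalPhenomena-18121`: no workfiles).
Landed Negative lemmas (`Theorems/AxialHelsonCone/Negative/GuardLoadBearing.lean`, p160326): the guard `1 ≤ b` is
load-bearing (`axialHelsonCone_false_without_one_le_b`) — honoured: the engine stub carries `1 ≤ b` and `1 ≤ n₀ ≤ N`
explicitly and is only ever applied there; `b = 1` / `N = 0` minors are equalities (`axialHelsonCone_minor_at_one`,
`_at_zero_left`) — consistent (the engine's conclusion at `b = 1` is an equality too). Refuter tightness: `ℓ₀ ≥ 2` is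
necessary numerically ((1,2) fails) — consistent: `σ(1) < σ(2)` in the MC (lattice zone), so any witness has `n₀ ≥ 2`.
Negatives index (`ledger negatives --problem CriticalPhenomena`): 11 refuted statements, all in CardyFormulaZ2 /
PercolationContinuityZ3 / SAWScalingLimit — none concerns `criticalTwoPoint 3`; neither stub is an instance of a refuted
strengthening.
-/

noncomputable section

namespace Summit.CriticalPhenomena.Ising3DConformalLimit.Cruxes.AxialHelsonCone.Birth

open scoped BigOperators Topology Classical
open Filter Set Function
open Literature.Probability.LatticeModels

/-! ## The two registered stubs (signatures fully qualified, over importable vocabulary only) -/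

/-- **STUB 1 · `stub_localExponentAntitone` (OPEN — load-bearing) — the discrete local exponent of the axial
critical two-point function of the n.n. Ising model on `ℤ³` is eventually non-increasing.**
With `g(n) = criticalTwoPoint 3 (Pi.single 0 n)` and `σ(n) = log(g(n)/g(n+1)) / log((n+1)/n)`:
`∃ n₀ ≥ 1, ∀ n ≥ n₀, σ(n+1) ≤ σ(n)`. One derivative beyond the in-tree RP fact `criticalTwoPoint_axis_ratio_mono`
(`σ(n)·log(1+1/n)` non-increasing); numerically `s_eff ↓` from `n = 2` to `31` (route MC j022798/j022800); asymptotically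
the sign `b₀ > 0` of the leading axial correction to scaling. Asserts no exponent value, amplitude or rate.
[AizenmanDuminilCopinAnnals2021 Prop 5.3; arXiv:1912.07973 §5.5; DuminilCopinICM2022 §8.4; arXiv:1004.4486;
arXiv:1711.10946 §7; in tree: criticalTwoPoint_axis_ratio_mono, criticalTwoPoint_axis_ratio_tendsto_one'] -/
theorem stub_localExponentAntitone :
    ∃ n₀ : ℕ, 1 ≤ n₀ ∧ ∀ n : ℕ, n₀ ≤ n →
      Real.log (Literature.Probability.LatticeModels.criticalTwoPoint 3 (Pi.single (0 : Fin 3) ((n + 1 : ℕ) : ℤ)) /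
            Literature.Probability.LatticeModels.criticalTwoPoint 3 (Pi.single (0 : Fin 3) ((n + 2 : ℕ) : ℤ))) /
          Real.log (((n : ℝ) + 2) / ((n : ℝ) + 1)) ≤
        Real.log (Literature.Probability.LatticeModels.criticalTwoPoint 3 (Pi.single (0 : Fin 3) (n : ℤ)) /
            Literature.Probability.LatticeModels.criticalTwoPoint 3 (Pi.single (0 : Fin 3) ((n + 1 : ℕ) : ℤ))) /
          Real.log (((n : ℝ) + 1) / (n : ℝ)) := by
  sorry

/-- **STUB 2 · `stub_antitoneExponentTransfer` (ENGINE — pure real analysis, provable, M) — an eventually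
non-increasing discrete local exponent makes every 2×2 multiplicative (Helson) minor non-negative from the same
threshold, uniformly in the ratio.** For every positive sequence `f` and `n₀ ≥ 1`: if
`σ_f(n+1) ≤ σ_f(n)` for all `n ≥ n₀`, `σ_f(n) = log(f(n)/f(n+1)) / log((n+1)/n)`, then
`f(N b)² ≤ f(N) · f(N b²)` for all `N ≥ n₀`, `b ≥ 1`. Mechanism: telescoping `log f(bn) − log f(bn+b) = Σ_{k=bn}^{bn+b−1} σ_f(k)·log((k+1)/k)
≤ σ_f(n)·log((n+1)/n) = log f(n) − log f(n+1)` (`k ≥ bn ≥ n ≥ n₀`), so `n ↦ f(bn)/f(n)` is non-decreasing on `[n₀,∞)`,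
whence `f(Nb)/f(N) ≤ f(Nb²)/f(Nb)`. [folklore; Mathlib: Real.log_div, Real.log_le_log_iff, Finset.sum_range_succ, Finset.prod_range_succ] -/
theorem stub_antitoneExponentTransfer :
    ∀ (f : ℕ → ℝ) (n₀ : ℕ), (∀ n : ℕ, 0 < f n) → 1 ≤ n₀ →
      (∀ n : ℕ, n₀ ≤ n →
        Real.log (f (n + 1) / f (n + 2)) / Real.log (((n : ℝ) + 2) / ((n : ℝ) + 1)) ≤
          Real.log (f n / f (n + 1)) / Real.log (((n : ℝ) + 1) / (n : ℝ))) →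
      ∀ N b : ℕ, n₀ ≤ N → 1 ≤ b → f (N * b) ^ 2 ≤ f N * f (N * b ^ 2) := by
  sorry

/-! ## Names for the statements (hypotheses of the composition)

The skeleton audit admits, as hypotheses of the theorem that concludes the crux, only registered obligations or the
declared stubs BY NAME; `Statement.stub_x` is the statement of `stub_x` (its `type_of%`). -/

namespace Statement

/-- Statement of `stub_localExponentAntitone`. -/
abbrev stub_localExponentAntitone : Prop := type_of% Birth.stub_localExponentAntitone
/-- Statement of `stub_antitoneExponentTransfer`. -/
abbrev stub_antitoneExponentTransfer : Prop := type_of% Birth.stub_antitoneExponentTransfer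

end Statement

/-! ## Local shorthand (verbatim sub-terms of the route decl), certified by `Iff.rfl` -/

/-- `g(n) = ⟨σ₀σ_{n e₀}⟩⁺_{β_c(3)}`, the axial critical two-point function of the n.n. Ising model on `ℤ³`. -/
def g (n : ℕ) : ℝ := Literature.Probability.LatticeModels.criticalTwoPoint 3 (Pi.single (0 : Fin 3) (n : ℤ))

/-- The discrete local exponent `σ_f(n) = log(f(n)/f(n+1)) / log((n+1)/n)` of a sequence `f` (junk `0` at `n = 0`). -/
def localExponent (f : ℕ → ℝ) (n : ℕ) : ℝ :=
  Real.log (f n / f (n + 1)) / Real.log (((n : ℝ) + 1) / (n : ℝ))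

/-- The crux, read through `g`. -/
theorem crux_iff :
    Summit.CriticalPhenomena.Ising3DConformalLimit.Theses.HelsonAxis.AxialHelsonCone ↔
      ∃ ℓ₀ : ℕ, 0 < ℓ₀ ∧ ∀ N b : ℕ, ℓ₀ ≤ N → 1 ≤ b → g (N * b) ^ 2 ≤ g N * g (N * b ^ 2) :=
  Iff.rfl

/-- `stub_localExponentAntitone`, read through `g`: `σ_g(n+1) ≤ σ_g(n)` eventually (the denominators are written
`log((n+2)/(n+1))`, `log((n+1)/n)`). -/
theorem stub_localExponentAntitone_iff :
    Statement.stub_localExponentAntitone ↔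
      ∃ n₀ : ℕ, 1 ≤ n₀ ∧ ∀ n : ℕ, n₀ ≤ n →
        Real.log (g (n + 1) / g (n + 2)) / Real.log (((n : ℝ) + 2) / ((n : ℝ) + 1)) ≤
          Real.log (g n / g (n + 1)) / Real.log (((n : ℝ) + 1) / (n : ℝ)) :=
  Iff.rfl

/-- The right-hand side of the stub inequalities IS the local exponent `σ_f(n)` (definitional readback). -/
theorem localExponent_eq (f : ℕ → ℝ) (n : ℕ) :
    localExponent f n = Real.log (f n / f (n + 1)) / Real.log (((n : ℝ) + 1) / (n : ℝ)) :=
  rfl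

/-! ## Elementary facts used by the composition, and a calibration (proved) -/

/-- `0 < g(n)` on the axis (Simon–Lieb lower bound; in tree `criticalTwoPoint_axis_pos`). [folklore] -/
theorem g_pos (n : ℕ) : 0 < g n := criticalTwoPoint_axis_pos n

/-- Calibration (BC5-style special case for the engine's hypothesis class): a PURE POWER `n ↦ n^{-s}` has local
exponent identically `s` from `n = 1` on, so it satisfies the hypothesis of `stub_antitoneExponentTransfer` with
equality (and its conclusion with equality: `(Nb)^{-2s} = N^{-s}(Nb²)^{-s}`). Shows the definitions compute and the
hypothesis class is inhabited non-vacuously. [folklore] -/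
theorem localExponent_rpow (s : ℝ) {n : ℕ} (hn : 1 ≤ n) :
    localExponent (fun k : ℕ => (k : ℝ) ^ (-s)) n = s := by
  unfold localExponent
  have hn0 : (0 : ℝ) < (n : ℝ) := by exact_mod_cast hn
  have hn1 : (0 : ℝ) < (n : ℝ) + 1 := by linarith
  have hcast : (((n + 1 : ℕ) : ℝ)) = (n : ℝ) + 1 := by push_cast; ring
  have hL : 0 < Real.log (((n : ℝ) + 1) / (n : ℝ)) := by
    apply Real.log_pos
    rw [one_lt_div hn0]
    linarith
  have hnum : Real.log ((n : ℝ) ^ (-s) / (((n + 1 : ℕ) : ℝ)) ^ (-s)) = s * Real.log (((n : ℝ) + 1) / (n : ℝ)) := by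
    rw [hcast, Real.log_div (Real.rpow_pos_of_pos hn0 _).ne' (Real.rpow_pos_of_pos hn1 _).ne',
      Real.log_rpow hn0, Real.log_rpow hn1, Real.log_div hn1.ne' hn0.ne']
    ring
  rw [hnum, mul_div_assoc, div_self hL.ne', mul_one]

/-! ## The composition (kernel-checked, no sorry): the two stubs give the crux BY NAME -/

/-- **`AxialHelsonCone` from the stubs.** Take the threshold `n₀ ≥ 1` of the open stub; apply the engine to the
axial function `f := g` (positive by Simon–Lieb) with that threshold; `ℓ₀ := n₀`. -/
theorem AxialHelsonCone_of (h₁ : Statement.stub_localExponentAntitone)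
    (h₂ : Statement.stub_antitoneExponentTransfer) :
    Summit.CriticalPhenomena.Ising3DConformalLimit.Theses.HelsonAxis.AxialHelsonCone := by
  rw [stub_localExponentAntitone_iff] at h₁
  rw [crux_iff]
  obtain ⟨n₀, hn₀, hmono⟩ := h₁
  refine ⟨n₀, lt_of_lt_of_le Nat.zero_lt_one hn₀, fun N b hN hb => ?_⟩
  exact h₂ g n₀ g_pos hn₀ hmono N b hN hb

end Summit.CriticalPhenomena.Ising3DConformalLimit.Cruxes.AxialHelsonCone.Birth

end
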